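import Literature.NumberTheory.Automorphic.LocalHermitianPlaneCongruence
import Literature.NumberTheory.Automorphic.LocalHermitianFormsRankThree
import HarnessLib

/-!
# Ternary hermitian forms with LOCAL coefficients: at a non-split place every non-degenerate `G ∈ M₃(E_v)` is `≅ a • Φ₃`, and two of them
# are congruent iff their determinants agree modulo norms (Jacobowitz's rank-3 classification)

(Jacobowitz, *Hermitian forms over local fields*, Amer. J. Math. 84 (1962), §3 Thm. 3.1; Scharlau, *Quadratic and Hermitian Forms*, Ch. 10 §1.)

Topic `NumberTheory/Automorphic`; namespace `Literature.NumberTheory.Automorphic.UnitaryGroup`.  THEOREMS ONLY (no definition, no named fact, no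
instance, no notation, no `sorry`).  Cell `pub/hodgecm-mathlib`, programme P3a, road «D-N7-inert» (the inert unit fundamental lemma [Rogawski1990,
Prop. 4.9.1 (b)]), brick (L4a) «local class set» of A-p06's map: the LOCAL-COEFFICIENT rank-3 twin of ★ `LocalHermitianPlaneCongruence`
(`exists_formCongr_eq_of_det_eq_mul_norm`, rank 2).  The tree's rank-3 normal form ★ `exists_formCongr_map_eq_smul_antidiag_of_smul_eq`
(`LocalHermitianFormsRankThree`) is stated for a GLOBAL matrix `H.map (algebraMap E E_v)`; the transported forms `H · x` of the local Cartan
classes (★ `Rogawski1990.CartanInvariant`, `CartanRealisation`) have LOCAL coefficients — this file supplies the local-coefficient statements, which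
the local class-set file `Rogawski1990/LocalStableClassesNonsplit` consumes.  HC_CM is proved only modulo the printed citations until rung 0 closes;
this file is unconditional local algebra.

THE MATHEMATICS.  `E ∕ F` quadratic number fields, `c` the non-trivial automorphism, `v` a finite place of `F` NOT split in `E` (`w ∣ v`, `c • w = w`, so
`E_v = E ⊗_F F_v` is a field, ★ `isField_localRing_of_nonsplit`), `σ = c ⊗ 1` (★ `conjLocal`).  A `σ`-hermitian `G ∈ M₃(E_v)` with `det G` a unit is
ISOTROPIC (★ `exists_ne_zero_hermForm_self_eq_zero_of_three_le`: the trace form has `6 > u(F_v) = 4` variables), an isotropic vector has a hyperbolic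
partner (★ `exists_hyperbolic_partner_hermForm`), and a hyperbolic pair completes to a frame in which `G` is `a • Φ₃`, `a = σ a ≠ 0` (★
`exists_formCongr_eq_smul_antidiag_of_hyperbolicPair`) — §1 `exists_isUnit_formCongr_eq_smul_antidiag_three`.  For two such forms `G ≅ a • Φ₃`,
`G′ ≅ a′ • Φ₃` with `det G′ = det G · σ(z) z`: `b = a′∕a` is `σ`-fixed with `b³` a norm (determinants: `det (a • Φ₃) = a³ det Φ₃ = det G · N(det T)`), so
`b = b³ ∕ N(b)` is a norm `N(y)`, and the scalar `y • 1` carries `a • Φ₃` to `a′ • Φ₃` — §2 **`exists_formCongr_eq_of_det_eq_mul_norm_three`** (odd rank: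
no anisotropic kernel survives, the two classes of ternary forms differ by a scalar); with the converse ★ `det_formCongr_eq_mul_norm` this is the
classification of ternary hermitian forms over `E_v ∕ F_v` by `det ∈ F_vˣ ∕ N(E_vˣ)` (`exists_formCongr_eq_iff_det_three`).

## References
* [Jacobowitz1962] R. Jacobowitz, *Hermitian forms over local fields*, Amer. J. Math. 84 (1962) 441–465, §3 Thm. 3.1.
* [Scharlau1985HermitianForms] W. Scharlau, *Quadratic and Hermitian Forms*, Grundlehren 270 (1985), Ch. 10 §1 (1.1), (1.6).
* [Rogawski1990] J. D. Rogawski, *Automorphic Representations of Unitary Groups in Three Variables*, Ann. of Math. Stud. 123 (1990), §3.5 Prop. 3.5.2 (a)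
  p. 29, §14.2 p. 232 (i).
-/

set_option autoImplicit false

noncomputable section

open Matrix NumberField IsDedekindDomain

namespace Literature.NumberTheory.Automorphic.UnitaryGroup

section Local

variable {F : Type} (E : Type) [Field F] [NumberField F] [Field E] [NumberField E] [Algebra F E]
  [Algebra.IsQuadraticExtension F E] (v : HeightOneSpectrum (𝓞 F)) (c : E ≃ₐ[F] E) {δ : E} (hcδ : c δ = -δ) (hδ : δ ≠ 0)

/-! ## §1 Every non-degenerate ternary hermitian form with local coefficients is `≅ a • Φ₃` at a non-split place -/

include hcδ hδ in
/-- **`G ≅ a • Φ₃` for LOCAL coefficients.**  At a finite place `v` of `F` not split in `E` (`w ∣ v`, `c • w = w`), every `(c ⊗ 1)`-hermitian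
`G ∈ M₃(E_v)` with `det G` a unit satisfies `ᵗσ(T) · G · T = a • Φ₃` for some `T ∈ GL₃(E_v)` and some `σ`-fixed unit `a` of `E_v`
(`Φ₃ = antidiag(1,1,1)`): `G` is isotropic (★ `exists_ne_zero_hermForm_self_eq_zero_of_three_le`), an isotropic vector has a hyperbolic partner in the
field `E_v` (★ `exists_hyperbolic_partner_hermForm`), and the pair completes to the frame of ★ `exists_formCongr_eq_smul_antidiag_of_hyperbolicPair`.
[cite: Jacobowitz1962, §3 Thm. 3.1] [cite: Rogawski1990, §14.2 p. 232] -/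
theorem exists_isUnit_formCongr_eq_smul_antidiag_three (w : PlacesOver E v) (hw : c • w.1 = w.1)
    {G : Matrix (Fin 3) (Fin 3) (LocalRing E v)} (hG : (G.map (conjLocal E c v))ᵀ = G) (hGd : IsUnit G.det) :
    ∃ (T : GL (Fin 3) (LocalRing E v)) (a : LocalRing E v), IsUnit a ∧ conjLocal E c v a = a ∧
      formCongr (conjLocal E c v) T G =
        a • (Matrix.of fun i j : Fin 3 => if i.val + j.val + 1 = 3 then (1 : LocalRing E v) else 0) := by
  haveI : CharZero (v.adicCompletion F) := charZero_of_injective_algebraMap (algebraMap F _).injective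
  letI : Field (LocalRing E v) :=
    (Liu2021.LemD1IndexedNonVacuityNonsplitPlace.isField_localRing_of_nonsplit E v c hcδ hδ w hw).toField
  have hσσ : ∀ s, conjLocal E c v (conjLocal E c v s) = s := Liu2021.LemD1OfPlace.conjLocal_conjLocal_apply E v c hcδ hδ
  have h2 : (2 : LocalRing E v) ≠ 0 := by
    rw [show (2 : LocalRing E v) = algebraMap (v.adicCompletion F) (LocalRing E v) 2 from (map_ofNat _ 2).symm]
    exact (map_ne_zero_iff _ (RingHom.injective _)).2 two_ne_zero
  obtain ⟨r, hr0, hr⟩ := exists_ne_zero_hermForm_self_eq_zero_of_three_le E v c hcδ hδ le_rfl hG hGd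
  obtain ⟨r', hr', hrr'⟩ := exists_hyperbolic_partner_hermForm (conjLocal E c v) _ h2 hσσ hG hGd.ne_zero hr hr0
  obtain ⟨T, a, ha0, hσa, hT⟩ :=
    exists_formCongr_eq_smul_antidiag_of_hyperbolicPair (conjLocal E c v) G hσσ hG hGd.ne_zero hr hr' hrr'
  exact ⟨T, a, IsUnit.mk0 a ha0, hσa, hT⟩

/-! ## §2 Same determinant class modulo norms ⇒ congruent (rank 3) -/

/-- A scalar change of basis rescales a form by a norm: `ᵗσ(y • 1) · M · (y • 1) = (σ(y) y) • M`. [folklore] -/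
private theorem formCongr_mkOfDetNeZero_smul_one {K : Type*} [Field K] (σ : K →+* K) {n : Type*} [Fintype n] [DecidableEq n]
    (y : K) (h : ((y • (1 : Matrix n n K))).det ≠ 0) (M : Matrix n n K) :
    formCongr σ (Matrix.GeneralLinearGroup.mkOfDetNeZero (y • (1 : Matrix n n K)) h) M = (σ y * y) • M := by
  change ((y • (1 : Matrix n n K)).map σ)ᵀ * M * (y • (1 : Matrix n n K)) = (σ y * y) • M
  rw [Matrix.smul_one_eq_diagonal, Matrix.diagonal_map (map_zero σ), Matrix.diagonal_transpose]
  ext i j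
  simp only [Matrix.mul_diagonal, Matrix.diagonal_mul, Matrix.smul_apply, smul_eq_mul]
  ring

/-- **The odd-rank scalar bookkeeping** (pure field algebra): if `a³ d = g · N(t)`, `a′³ d = g′ · N(t′)`, `g′ = g · N(z)` with `a, a′` `σ`-fixed and
everything non-zero, then `a′ = N(y) · a` for some `y ≠ 0` (`b = a′∕a` has `b³ = N(z t′∕t)` and `N(b) = b²`, so `b = N(z t′ ∕ (t b))`). [folklore] -/
private theorem exists_eq_norm_mul_of_cube {K : Type*} [Field K] (σ : K →+* K) {a a' t t' z d g g' : K}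
    (ha : a ≠ 0) (ha' : a' ≠ 0) (ht : t ≠ 0) (hd : d ≠ 0) (hσa : σ a = a) (hσa' : σ a' = a')
    (hdT : a ^ 3 * d = g * (σ t * t)) (hdT' : a' ^ 3 * d = g' * (σ t' * t')) (hz : g' = g * (σ z * z)) :
    ∃ y : K, y ≠ 0 ∧ a' = σ y * y * a := by
  have hσt : σ t ≠ 0 := (map_ne_zero σ).2 ht
  -- cancel `d`: `a′³ N(t) = a³ N(z) N(t′)`
  have h1 : d * (a' ^ 3 * (σ t * t)) = d * (a ^ 3 * (σ z * σ t' * (z * t'))) := by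
    calc d * (a' ^ 3 * (σ t * t)) = a' ^ 3 * d * (σ t * t) := by ring
      _ = g * (σ z * z) * (σ t' * t') * (σ t * t) := by rw [hdT', hz]
      _ = g * (σ t * t) * (σ z * σ t' * (z * t')) := by ring
      _ = a ^ 3 * d * (σ z * σ t' * (z * t')) := by rw [← hdT]
      _ = d * (a ^ 3 * (σ z * σ t' * (z * t'))) := by ring
  have h1' := mul_left_cancel₀ hd h1
  -- `b³ = N(y₀)`, `b = a′/a`, `y₀ = z t′ / t`
  have hb3 : (a' / a) ^ 3 = σ (z * t' / t) * (z * t' / t) := by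
    rw [div_pow, map_div₀, map_mul, div_mul_div_comm, div_eq_div_iff (pow_ne_zero 3 ha) (mul_ne_zero hσt ht)]
    linear_combination h1'
  have hb0 : a' / a ≠ 0 := div_ne_zero ha' ha
  have hσb : σ (a' / a) = a' / a := by rw [map_div₀, hσa, hσa']
  refine ⟨z * t' / t / (a' / a), ?_, ?_⟩
  · intro h
    rcases div_eq_zero_iff.1 h with h | h
    · rw [h, map_zero, zero_mul] at hb3
      exact hb0 ((pow_eq_zero_iff (n := 3) (by norm_num)).1 hb3)
    · exact hb0 h
  · have key : a' / a = σ (z * t' / t / (a' / a)) * (z * t' / t / (a' / a)) := by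
      rw [map_div₀ σ (z * t' / t), hσb, div_mul_div_comm, ← hb3, eq_div_iff (mul_ne_zero hb0 hb0)]
      ring
    calc a' = a' / a * a := by rw [div_mul_cancel₀ a' ha]
      _ = σ (z * t' / t / (a' / a)) * (z * t' / t / (a' / a)) * a := by rw [← key]

include hcδ hδ in
/-- **JACOBOWITZ, RANK 3, LOCAL COEFFICIENTS — same determinant class ⇒ congruent.**  At a finite place `v` of `F` NOT split in `E` (`w ∣ v`,
`c • w = w`), two `(c ⊗ 1)`-hermitian matrices `G, G′ ∈ M₃(E_v)` with unit determinants that differ by a norm, `det G′ = det G · σ(z) z` with `z ∈ E_vˣ`,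
are congruent: `ᵗσ(T) · G · T = G′` for some `T ∈ GL₃(E_v)`.  (Both are `≅ a • Φ₃`, `≅ a′ • Φ₃` by §1; `b = a′∕a` is `σ`-fixed with `b³ = N(y₀)`
from the determinants, hence `b = b³ ∕ (σ(b) b) = N(y₀ ∕ b)`, and the scalar matrix `(y₀∕b) • 1` carries `a • Φ₃` to `a′ • Φ₃`.)
[cite: Jacobowitz1962, §3 Thm. 3.1] [cite: Scharlau1985HermitianForms, Ch. 10 §1] [cite: Rogawski1990, §3.5 Prop. 3.5.2 (a) p. 29] -/
theorem exists_formCongr_eq_of_det_eq_mul_norm_three (w : PlacesOver E v) (hw : c • w.1 = w.1)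
    {G G' : Matrix (Fin 3) (Fin 3) (LocalRing E v)} (hG : (G.map (conjLocal E c v))ᵀ = G) (hG' : (G'.map (conjLocal E c v))ᵀ = G')
    (hGd : IsUnit G.det) (hG'd : IsUnit G'.det)
    (hdet : ∃ z : LocalRing E v, IsUnit z ∧ G'.det = G.det * (conjLocal E c v z * z)) :
    ∃ T : GL (Fin 3) (LocalRing E v), formCongr (conjLocal E c v) T G = G' := by
  letI : Field (LocalRing E v) :=
    (Liu2021.LemD1IndexedNonVacuityNonsplitPlace.isField_localRing_of_nonsplit E v c hcδ hδ w hw).toField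
  obtain ⟨T, a, ha, hσa, hT⟩ := exists_isUnit_formCongr_eq_smul_antidiag_three E v c hcδ hδ w hw hG hGd
  obtain ⟨T', a', ha', hσa', hT'⟩ := exists_isUnit_formCongr_eq_smul_antidiag_three E v c hcδ hδ w hw hG' hG'd
  obtain ⟨z, -, hzdet⟩ := hdet
  -- determinants: `a³ det Φ = det G · N(det T)`, `a′³ det Φ = det G′ · N(det T′)`
  have hdT := det_formCongr_eq_mul_norm (conjLocal E c v) T G
  have hdT' := det_formCongr_eq_mul_norm (conjLocal E c v) T' G'
  rw [hT, Matrix.det_smul, Fintype.card_fin] at hdT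
  rw [hT', Matrix.det_smul, Fintype.card_fin] at hdT'
  have hTd : (T : Matrix (Fin 3) (Fin 3) (LocalRing E v)).det ≠ 0 := by
    have h := T.isUnit
    rw [Matrix.isUnit_iff_isUnit_det] at h
    exact h.ne_zero
  have hΦd : (Matrix.of fun i j : Fin 3 => if i.val + j.val + 1 = 3 then (1 : LocalRing E v) else 0).det ≠ 0 := by
    intro h0
    rw [h0, mul_zero] at hdT
    exact mul_ne_zero hGd.ne_zero (mul_ne_zero ((map_ne_zero _).2 hTd) hTd) hdT.symm
  obtain ⟨y, hy0, hy⟩ := exists_eq_norm_mul_of_cube (conjLocal E c v) ha.ne_zero ha'.ne_zero hTd hΦd hσa hσa' hdT hdT' hzdet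
  -- the scalar matrix `y • 1`
  have hSdet : (y • (1 : Matrix (Fin 3) (Fin 3) (LocalRing E v))).det ≠ 0 := by
    rw [Matrix.det_smul, Matrix.det_one, mul_one, Fintype.card_fin]
    exact pow_ne_zero 3 hy0
  have hS' : formCongr (conjLocal E c v) (Matrix.GeneralLinearGroup.mkOfDetNeZero _ hSdet)
      (a • (Matrix.of fun i j : Fin 3 => if i.val + j.val + 1 = 3 then (1 : LocalRing E v) else 0)) =
      a' • (Matrix.of fun i j : Fin 3 => if i.val + j.val + 1 = 3 then (1 : LocalRing E v) else 0) := by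
    rw [formCongr_mkOfDetNeZero_smul_one, smul_smul, ← hy]
  refine ⟨T * Matrix.GeneralLinearGroup.mkOfDetNeZero _ hSdet * T'⁻¹, ?_⟩
  rw [formCongr_mul, formCongr_mul, hT, hS', ← hT', formCongr_inv_formCongr]

include hcδ hδ in
/-- **Ternary hermitian forms over `E_v ∕ F_v` (non-split `v`) are classified by the determinant modulo norms**: for `(c ⊗ 1)`-hermitian
`G, G′ ∈ M₃(E_v)` with unit determinants, `(∃ T, ᵗσ(T) G T = G′) ↔ ∃ z ∈ E_vˣ, det G′ = det G · σ(z) z` (§2 and ★ `det_formCongr_eq_mul_norm`).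
[cite: Jacobowitz1962, §3 Thm. 3.1] [cite: Scharlau1985HermitianForms, Ch. 10 §1] -/
theorem exists_formCongr_eq_iff_det_three (w : PlacesOver E v) (hw : c • w.1 = w.1)
    {G G' : Matrix (Fin 3) (Fin 3) (LocalRing E v)} (hG : (G.map (conjLocal E c v))ᵀ = G) (hG' : (G'.map (conjLocal E c v))ᵀ = G')
    (hGd : IsUnit G.det) (hG'd : IsUnit G'.det) :
    (∃ T : GL (Fin 3) (LocalRing E v), formCongr (conjLocal E c v) T G = G') ↔
      ∃ z : LocalRing E v, IsUnit z ∧ G'.det = G.det * (conjLocal E c v z * z) := by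
  refine ⟨?_, exists_formCongr_eq_of_det_eq_mul_norm_three E v c hcδ hδ w hw hG hG' hGd hG'd⟩
  rintro ⟨T, rfl⟩
  letI : Field (LocalRing E v) :=
    (Liu2021.LemD1IndexedNonVacuityNonsplitPlace.isField_localRing_of_nonsplit E v c hcδ hδ w hw).toField
  have hTd : IsUnit (T : Matrix (Fin 3) (Fin 3) (LocalRing E v)).det := by
    have := T.isUnit; rwa [Matrix.isUnit_iff_isUnit_det] at this
  exact ⟨_, hTd, det_formCongr_eq_mul_norm (conjLocal E c v) T G⟩

end Local

end Literature.NumberTheory.Automorphic.UnitaryGroup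

end
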